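import Summits.RiemannHypothesis.RiemannHypothesis.Theses.RuelleBand
import Summits.RiemannHypothesis.RiemannHypothesis.Theorems.RuelleBandExactFirstBandStubEvenSymTranslate
import Summits.RiemannHypothesis.RiemannHypothesis.Theorems.RuelleBandExactFirstBandStubEvenExpSum
import Summits.RiemannHypothesis.RiemannHypothesis.Theorems.RuelleBandExactFirstBandStubEvenEngine
import Summits.RiemannHypothesis.RiemannHypothesis.Theorems.RuelleBandExactFirstBandStubEvenTestExists
import Summits.RiemannHypothesis.RiemannHypothesis.Theorems.RuelleBandExactFirstBandStubEvenTransfer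
import Summits.RiemannHypothesis.RiemannHypothesis.Theorems.RuelleBandExactFirstBandStubEvenCalibration
import HarnessLib.Audit

/-!
# Line `SketchIdeator1` (even Weil sector) — skeleton for crux `RuelleBand.ExactFirstBand`
(item stmt-RiemannHypothesis-2061, route route-RiemannHypothesis-RuelleBand; second line lead `…-c1-0`, end of cycle 1)

Crux (FIXED, route decl): `ExactFirstBand : ∀ s, ζ s = 0 → 0 < re s → re s < 1 → re s = 1/2 ∨ im s = 0`
(RH-equivalent in tree, `Negative.exactFirstBand_iff_riemannHypothesis`).

Idea (crux idea `fe-even-weil-sector`, ideator 1; passed both triage panels): restrict Weil's hermitian form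
`Q(g) = W(g ⋆ g̃)` (tree `weilQuadratic`) to the sector of REAL test functions that are EVEN (invariant under the
functional-equation involution `t ↦ -t`).  On that sector the zero side is `Σ_ρ m(ρ) ĝ(ρ)²`: zeros on the critical
line AND on the real axis contribute squares `≥ 0`, only an off-axis quadruple contributes the indefinite
`4 Re ĝ(ρ)²` — the sector is X-shaped (blind to real zeros).  THE BET (single research stub, RH-strength):
`stub_evenWeilPositivity`, Weil positivity on the even real sector.  The closable layer — the even-sector Weil
criterion `EvenWeilPositivity → X` — is LANDED (cycle 1), along the route the first triage panel prescribed
(Landau, not amplification at an extremal zero):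

* `stub_evenSymTranslate` (p98879): symmetric translates `h_x = (g(·-x)+g(·+x))/2` stay in the sector and
  `Q_zero(h_x) = (Re B_g(2x) + Q_zero(g))/2`, `B_g = WeilConverse.expSum g`;
* `stub_evenExpSum` (p99505): for even `g`, `B_g` is real and even — so the bet gives the ONE-SIDED bound `B_g ≥ -Q(g)`;
* `stub_evenEngine` (p100321; analytic half `stub_evenEngine_transform` p99180): a real, bounded-below, absolutely
  convergent exponential sum with locally finite exponents none on the positive real axis has no mode with
  `Re λ > 0` (Landau's theorem for the Mellin transform of `y ↦ F(log y) + M ≥ 0`, tree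
  `Landau.integrableOn_of_differentiableOn_union_convex`, then pole clearing as in `BoundedPowerSum.sum_fiber_eq_zero`);
* `stub_evenTestExists` (p98983): narrow even real bumps with `ĝ(ρ) ≠ 0`;
* `stub_evenTransfer` (p99193): bookkeeping for `ζ` (exponents `ρ - 1/2` never real: no zeros on `(0,1)`);
* `stub_evenCalibration` (p97729): X ⟹ the bet.

STATUS (end of cycle 1): the ONLY `sorry` is THE BET `stub_evenWeilPositivity`, which is EXACTLY X-strength
(`evenWeilCriterion` below, kernel-checked from landed files; = RH by `Negative.exactFirstBand_iff_riemannHypothesis`).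
No mechanism for the bet is claimed.  Second lead: line `Sketch` (heat cone / Gaussian semigroup) is held by lead
`prover-line-stmt-RiemannHypothesis-2061-1` and sits INSIDE this sector (`g_u` even real); no stub is shared.
-/

set_option linter.dupNamespace false

noncomputable section

open Complex MeasureTheory Filter Set
open scoped BigOperators Topology ComplexConjugate

namespace Summit.RiemannHypothesis.RiemannHypothesis.Cruxes.ExactFirstBand.EvenSector

open Summit.RiemannHypothesis.RiemannHypothesis.Theses.RuelleBand
open Summit.RiemannHypothesis.RiemannHypothesis.Theorems
open Literature.NumberTheory.LFunctions

/-! ### The registered stubs (signatures over existing declarations only) -/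

/-- **Stub 1 (M) — symmetric translates.** LANDED p98879. -/
theorem stub_evenSymTranslate :
    ∀ (g : ℝ → ℂ), IsWeilTest g → ∀ x : ℝ,
      IsWeilTest (fun t : ℝ => (g (t - x) + g (t + x)) / 2) ∧
      ((∀ t : ℝ, g (-t) = g t) → ∀ t : ℝ, (g (-t - x) + g (-t + x)) / 2 = (g (t - x) + g (t + x)) / 2) ∧
      ((∀ t : ℝ, (g t).im = 0) → ∀ t : ℝ, ((g (t - x) + g (t + x)) / 2).im = 0) ∧
      (∀ s : ℂ, weilMellin (fun t : ℝ => (g (t - x) + g (t + x)) / 2) s =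
        weilMellin g s * ((cexp ((s - 1 / 2) * x) + cexp (-((s - 1 / 2) * x))) / 2)) ∧
      WeilConverse.zeroForm (fun t : ℝ => (g (t - x) + g (t + x)) / 2) =
        ((((WeilConverse.expSum g (2 * x)).re : ℝ) : ℂ) + WeilConverse.zeroForm g) / 2 :=
  RuelleBandExactFirstBand.stub_evenSymTranslate

/-- **Stub 2 (S/M) — evenness makes the zero-side exponential sum real and even.** LANDED p99505. -/
theorem stub_evenExpSum :
    ∀ (g : ℝ → ℂ), IsWeilTest g → (∀ t : ℝ, g (-t) = g t) →
      (∀ s : ℂ, weilMellin g (1 - s) = weilMellin g s) ∧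
      ∀ y : ℝ, WeilConverse.expSum g (-y) = WeilConverse.expSum g y ∧ (WeilConverse.expSum g y).im = 0 :=
  RuelleBandExactFirstBand.stub_evenExpSum

/-- **Stub 3 (L) — THE ENGINE: a real exponential sum bounded below has no mode of positive real part (no positive
real exponent allowed).** LANDED p100321 (Landau half p99180). -/
theorem stub_evenEngine :
    ∀ (ι : Type) [Countable ι] (c lam : ι → ℂ) (R M : ℝ),
      Summable (fun i => ‖c i‖) → (∀ i, (lam i).re ≤ R) →
      (∀ z : ℂ, ∃ ε > 0, {i | lam i ∈ Metric.ball z ε}.Finite) →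
      (∀ i, 0 < (lam i).re → (lam i).im ≠ 0) →
      (∀ x : ℝ, 0 ≤ x → (∑' i, c i * cexp (lam i * x)).im = 0) →
      (∀ x : ℝ, 0 ≤ x → -M ≤ (∑' i, c i * cexp (lam i * x)).re) →
      ∀ μ : ℂ, 0 < μ.re → ∀ s : Finset ι, (∀ i, i ∈ s ↔ lam i = μ) → ∑ i ∈ s, c i = 0 :=
  RuelleBandExactFirstBand.stub_evenEngine

/-- **Stub 4 (S) — an even real test function seen by a given point.** LANDED p98983. -/
theorem stub_evenTestExists :
    ∀ ρ : ℂ, ∃ g : ℝ → ℂ, IsWeilTest g ∧ (∀ t : ℝ, g (-t) = g t) ∧ (∀ t : ℝ, (g t).im = 0) ∧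
      weilMellin g ρ ≠ 0 :=
  RuelleBandExactFirstBand.stub_evenTestExists

/-- **Stub 5 (M) — transfer to `ζ` (bookkeeping).** LANDED p99193. -/
theorem stub_evenTransfer :
    (∀ (ι : Type) [Countable ι] (c lam : ι → ℂ) (R M : ℝ),
      Summable (fun i => ‖c i‖) → (∀ i, (lam i).re ≤ R) →
      (∀ z : ℂ, ∃ ε > 0, {i | lam i ∈ Metric.ball z ε}.Finite) →
      (∀ i, 0 < (lam i).re → (lam i).im ≠ 0) →
      (∀ x : ℝ, 0 ≤ x → (∑' i, c i * cexp (lam i * x)).im = 0) →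
      (∀ x : ℝ, 0 ≤ x → -M ≤ (∑' i, c i * cexp (lam i * x)).re) →
      ∀ μ : ℂ, 0 < μ.re → ∀ s : Finset ι, (∀ i, i ∈ s ↔ lam i = μ) → ∑ i ∈ s, c i = 0) →
    (∀ (g : ℝ → ℂ), IsWeilTest g → ∀ x : ℝ,
      IsWeilTest (fun t : ℝ => (g (t - x) + g (t + x)) / 2) ∧
      ((∀ t : ℝ, g (-t) = g t) → ∀ t : ℝ, (g (-t - x) + g (-t + x)) / 2 = (g (t - x) + g (t + x)) / 2) ∧
      ((∀ t : ℝ, (g t).im = 0) → ∀ t : ℝ, ((g (t - x) + g (t + x)) / 2).im = 0) ∧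
      (∀ s : ℂ, weilMellin (fun t : ℝ => (g (t - x) + g (t + x)) / 2) s =
        weilMellin g s * ((cexp ((s - 1 / 2) * x) + cexp (-((s - 1 / 2) * x))) / 2)) ∧
      WeilConverse.zeroForm (fun t : ℝ => (g (t - x) + g (t + x)) / 2) =
        ((((WeilConverse.expSum g (2 * x)).re : ℝ) : ℂ) + WeilConverse.zeroForm g) / 2) →
    (∀ (g : ℝ → ℂ), IsWeilTest g → (∀ t : ℝ, g (-t) = g t) →
      (∀ s : ℂ, weilMellin g (1 - s) = weilMellin g s) ∧
      ∀ y : ℝ, WeilConverse.expSum g (-y) = WeilConverse.expSum g y ∧ (WeilConverse.expSum g y).im = 0) →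
    (∀ ρ : ℂ, ∃ g : ℝ → ℂ, IsWeilTest g ∧ (∀ t : ℝ, g (-t) = g t) ∧ (∀ t : ℝ, (g t).im = 0) ∧
      weilMellin g ρ ≠ 0) →
    (∀ g : ℝ → ℂ, IsWeilTest g → (∀ t : ℝ, g (-t) = g t) → (∀ t : ℝ, (g t).im = 0) →
      0 ≤ (weilQuadratic g).re) →
    ∀ s : ℂ, riemannZeta s = 0 → 0 < s.re → s.re < 1 → s.re = 1 / 2 ∨ s.im = 0 :=
  RuelleBandExactFirstBand.stub_evenTransfer

/-- **Stub 6 — THE BET `C⁺` (RH-strength; ⟺ X by `evenWeilCriterion`).** Weil positivity on the even real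
sector: `Re W(g ⋆ g̃) ≥ 0` for every smooth compactly supported `g` that is even and real-valued.  Under RH this
is `WeilPositivity.of_riemannHypothesis` restricted (`stub_evenCalibration`).  No mechanism is offered here. -/
theorem stub_evenWeilPositivity :
    ∀ g : ℝ → ℂ, IsWeilTest g → (∀ t : ℝ, g (-t) = g t) → (∀ t : ℝ, (g t).im = 0) →
      0 ≤ (weilQuadratic g).re := by
  sorry

/-! ### Calibration and the criterion (from landed files) -/

/-- **Calibration / honesty (X ⟹ the bet; not used in the composition).** LANDED p97729. -/
theorem exact_evenWeilPositivity (hX : ExactFirstBand) :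
    ∀ g : ℝ → ℂ, IsWeilTest g → (∀ t : ℝ, g (-t) = g t) → (∀ t : ℝ, (g t).im = 0) →
      0 ≤ (weilQuadratic g).re :=
  RuelleBandExactFirstBand.stub_evenCalibration hX

/-- **The even-sector Weil criterion (bet ⟺ X; kernel-checked from landed stubs 1–5 and the calibration).** The
line's single research stub carries EXACTLY the content of X (= RH in tree): no hidden strengthening. -/
theorem evenWeilCriterion :
    (∀ g : ℝ → ℂ, IsWeilTest g → (∀ t : ℝ, g (-t) = g t) → (∀ t : ℝ, (g t).im = 0) →
      0 ≤ (weilQuadratic g).re) ↔ ExactFirstBand :=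
  ⟨fun h => stub_evenTransfer stub_evenEngine stub_evenSymTranslate stub_evenExpSum stub_evenTestExists h,
    fun hX => exact_evenWeilPositivity hX⟩

/-! ### The composition (kernel-checked modulo THE BET) -/

/-- **The line closes the crux modulo its stubs** (now: modulo THE BET only): transfer (stub 5) applied to the
engine (stub 3), the symmetric-translate bookkeeping (stub 1), evenness (stub 2), the test functions (stub 4) and
THE BET (stub 6). -/
theorem ExactFirstBand_of : ExactFirstBand :=
  stub_evenTransfer stub_evenEngine stub_evenSymTranslate stub_evenExpSum stub_evenTestExists
    stub_evenWeilPositivity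

end Summit.RiemannHypothesis.RiemannHypothesis.Cruxes.ExactFirstBand.EvenSector

end
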